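import Literature.Analysis.FunctionSpaces.SchauderCompactSupport
import Literature.Analysis.FunctionSpaces.ContDiffHolderNormTwo
import Literature.Analysis.FunctionSpaces.HolderManifoldLaplacian
import Literature.Analysis.FunctionSpaces.ContDiffHolderMollify
import HarnessLib

/-!
# The global Schauder estimate on a closed manifold (Schauder program, C3/C4)

Topic `Literature/Analysis/FunctionSpaces`. Patching the compact-support estimate of part C2
(`exists_schauder_compact_support`) over the Hölder chart data `𝔄` of a compact manifold `M`
(Gilbarg–Trudinger 2001, Thm. 6.2 ⇒ the global interior estimate; on a closed manifold there is
no boundary): for a bounded operator `L : C^{2,α}_𝔄(M) →L C^{0,α}_𝔄(M)` which in every chart `j`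
of `𝔄` is a second-order operator `P_j` with coefficients obeying fixed ellipticity and Hölder
bounds — in the precise sense that the `j`-th chart piece of `L u` is
`ρ̂_j · P_j(ũ_j)` with `ũ_j = η_j · (u ∘ chart_j⁻¹)` the chart restriction of part 11 and
`ρ̂_j = 𝔄.piece 1 j` the pulled-back partition function — one has

  `‖u‖_{C^{2,α}_𝔄} ≤ C (‖L u‖_{C^{0,α}_𝔄} + sup_M |u|)`,

`C` depending only on `𝔄`, the frame, `α` and the coefficient bounds (so uniformly along a
segment of such operators). Proof: `v_j = piece u j = ρ̂_j ũ_j`, `P_j v_j = piece (Lu) j +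
[P_j, ρ̂_j] ũ_j`, the compact-support estimate for `v_j`, the `C^{2,α}` norm from frame entries
(part C1) and `ε`-interpolation of all lower-order quantities (part C1), absorbed.

* `exists_schauder_global` — the statement above.

Census item (2a) of `Literature.Geometry.Riemannian.gurskyViaclovsky_pathOpen_weighted_four`.
Everything is proved; no named facts.

## References

* D. Gilbarg, N. S. Trudinger, *Elliptic Partial Differential Equations of Second Order* (2001),
  Thm. 6.2, §6.1. [GilbargTrudinger2001]
-/

noncomputable section

open Filter Topology Function Metric Set
open scoped NNReal ContDiff InnerProductSpace RealInnerProductSpace Manifold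

namespace Literature.Analysis.FunctionSpaces

section Global

variable {ι : Type*} [Fintype ι] {κ : Type*} [Fintype κ] [DecidableEq κ]
  {E : Type} [NormedAddCommGroup E] [InnerProductSpace ℝ E] [FiniteDimensional ℝ E]
  [MeasurableSpace E] [BorelSpace E] [Nontrivial E]
  {M : Type*} [TopologicalSpace M] [ChartedSpace E M] [IsManifold 𝓘(ℝ, E) ∞ M] [CompactSpace M]

omit [MeasurableSpace E] [BorelSpace E] [Nontrivial E] in
/-- The pulled-back partition function `ρ̂_j = 𝔄.piece 1 j` times the chart restriction
`ũ_j = η_j · (u ∘ chart_j⁻¹)` is the chart piece: `piece u j = ρ̂_j ũ_j`. [folklore] -/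
theorem HolderChartData.piece_eq_piece_one_mul (𝔄 : HolderChartData ι E M) {r : ℝ≥0} (hr : r ≤ 1)
    {k : ℕ} (u : HolderManifoldFunction 𝔄 ℝ k r) (j : ι) (y : E) :
    𝔄.piece u j y = 𝔄.piece (fun _ : M => (1 : ℝ)) j y *
      chartRestrictCLM 𝔄 hr j (𝔄.cutoff j) (𝔄.contDiff_cutoff j) (𝔄.hasCompactSupport_cutoff j)
        (𝔄.tsupport_cutoff_subset j) u y := by
  rw [chartRestrictCLM_apply]
  by_cases hy : y ∈ (𝔄.chart j).target
  · set p := (𝔄.chart j).symm y with hp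
    rw [𝔄.piece_apply_of_mem _ hy, 𝔄.piece_apply_of_mem _ hy, smul_eq_mul, smul_eq_mul, smul_eq_mul,
      mul_one]
    by_cases hρ : 𝔄.ρ j p = 0
    · rw [← hp, hρ, zero_mul, zero_mul]
    · have hyK : y ∈ 𝔄.chart j '' tsupport (𝔄.ρ j) :=
        ⟨p, subset_closure (mem_support.2 hρ), (𝔄.chart j).right_inv hy⟩
      have h1 : 𝔄.cutoff j y = 1 :=
        ((𝔄.cutoff_eq_one j).filter_mono (nhds_le_nhdsSet hyK)).self_of_nhds
      rw [h1, one_mul]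
  · rw [𝔄.piece_apply_of_not_mem _ hy, 𝔄.piece_apply_of_not_mem _ hy, zero_mul]

omit [Fintype ι] [FiniteDimensional ℝ E] [MeasurableSpace E] [BorelSpace E] [Nontrivial E]
  [IsManifold 𝓘(ℝ, E) ∞ M] [CompactSpace M] in
/-- The chart pieces are bounded by `sup |u|` (`0 ≤ ρ_j ≤ 1`). [folklore] -/
theorem HolderChartData.norm_piece_le (𝔄 : HolderChartData ι E M) {u : M → ℝ} {A : ℝ}
    (hA : ∀ x, ‖u x‖ ≤ A) (j : ι) (y : E) : ‖𝔄.piece u j y‖ ≤ A := by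
  have hA0 : 0 ≤ A := (norm_nonneg _).trans (hA ((𝔄.chart j).symm y))
  by_cases hy : y ∈ (𝔄.chart j).target
  · rw [𝔄.piece_apply_of_mem _ hy, norm_smul]
    refine (mul_le_mul (b := 1) ?_ (hA _) (norm_nonneg _) zero_le_one).trans (by rw [one_mul])
    rw [Real.norm_eq_abs, abs_of_nonneg (𝔄.ρ.nonneg j _)]
    exact 𝔄.ρ.le_one j _
  · rw [𝔄.piece_apply_of_not_mem _ hy, norm_zero]
    exact hA0

omit [DecidableEq κ] [MeasurableSpace E] [BorelSpace E] [Nontrivial E] in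
set_option maxHeartbeats 800000 in
-- the final bookkeeping of this long proof exceeds the default budget
/-- **The estimate for one chart piece** (the core of `exists_schauder_global`): with all
constants supplied as hypotheses — the compact-support constant `C2` of part C2 for the chart
coefficients on `K = chart_j(tsupport ρ_j)`, the norm-from-entries constant `C1` and an
`ε`-interpolation constant `Cε` of part C1, bounds `Z…` of the derivatives of `ρ̂_j = piece 1 j`
and `Zη` of the cutoff — the `j`-th piece of `u` obeys
`‖piece u j‖_{2,α} ≤ C1 (A + C2 (2‖Lu‖ + (Kz + Kz') X + V))`, `X = 5(ε‖R_j‖‖u‖ + Cε Zη A) + 3Zη A`,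
`V = 5(ε‖u‖ + Cε A) + 3A`. [cite: GilbargTrudinger2001, Thm. 6.2] -/
theorem schauder_global_piece (𝔄 : HolderChartData ι E M) (bE : OrthonormalBasis κ ℝ E) {α : ℝ≥0}
    (hα1 : α < 1) (j : ι) (a : κ → κ → E → ℝ) (b : κ → E → ℝ) (c : E → ℝ) {Ka Kb : ℝ≥0}
    {ρ₁ : ℝ} (hρ₁ : 0 < ρ₁)
    (ha0 : ∀ i i', ∀ x ∈ thickening ρ₁ (𝔄.chart j '' tsupport (𝔄.ρ j)), ‖a i i' x‖ ≤ Ka)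
    (haH : ∀ i i', HolderOnWith Ka α (a i i') (thickening ρ₁ (𝔄.chart j '' tsupport (𝔄.ρ j))))
    (hb0 : ∀ l x, x ∈ thickening ρ₁ (𝔄.chart j '' tsupport (𝔄.ρ j)) → ‖b l x‖ ≤ Kb)
    (hbH : ∀ l, HolderOnWith Kb α (b l) (thickening ρ₁ (𝔄.chart j '' tsupport (𝔄.ρ j))))
    {C2 : ℝ≥0}
    (hC2 : ∀ (w : E → ℝ), MemContDiffHolder 2 α w → tsupport w ⊆ 𝔄.chart j '' tsupport (𝔄.ρ j) →
      ∀ (CP Ps D1s D1h Us Uh : ℝ≥0),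
        HolderWith CP α (fun x => (∑ i, ∑ i', a i i' x * iteratedFDeriv ℝ 2 w x ![bE i, bE i']) +
          (∑ l, b l x * fderiv ℝ w x (bE l)) + c x * w x) →
        (∀ x, ‖(∑ i, ∑ i', a i i' x * iteratedFDeriv ℝ 2 w x ![bE i, bE i']) +
          (∑ l, b l x * fderiv ℝ w x (bE l)) + c x * w x‖ ≤ Ps) →
        (∀ l x, ‖fderiv ℝ w x (bE l)‖ ≤ D1s) → (∀ l, HolderWith D1h α (fun x => fderiv ℝ w x (bE l))) →
        (∀ x, ‖w x‖ ≤ Us) → HolderWith Uh α w →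
        ∀ p q, HolderWith (C2 * (CP + Ps + D1s + D1h + Us + Uh)) α
          (fun x => iteratedFDeriv ℝ 2 w x ![bE p, bE q]))
    {C1 : ℝ} (hC10 : 0 ≤ C1) (hC1 : ∀ (v : ContDiffHolderFunction E ℝ 2 α) (H : ℝ≥0) (A : ℝ),
      (∀ p q, HolderWith H α (fun x => iteratedFDeriv ℝ 2 (v : E → ℝ) x ![bE p, bE q])) →
      (∀ x, ‖v x‖ ≤ A) → ‖v‖ ≤ C1 * (A + H))
    {ε Cε : ℝ} (hε : 0 < ε) (hCε0 : 0 ≤ Cε)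
    (hCε : ∀ (v : ContDiffHolderFunction E ℝ 2 α) (A : ℝ), (∀ x, ‖v x‖ ≤ A) →
      (∀ x, ‖fderiv ℝ (v : E → ℝ) x‖ ≤ ε * ‖v‖ + Cε * A) ∧
      (∀ x, ‖iteratedFDeriv ℝ 2 (v : E → ℝ) x‖ ≤ ε * ‖v‖ + Cε * A))
    {Z1s Z1h : κ → ℝ≥0} {Z2s Z2h : κ → κ → ℝ≥0} {Zη : ℝ≥0}
    (hZ1 : ∀ l, (∀ x, ‖fderiv ℝ (𝔄.piece (fun _ : M => (1 : ℝ)) j) x (bE l)‖ ≤ Z1s l) ∧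
      HolderWith (Z1h l) α (fun x => fderiv ℝ (𝔄.piece (fun _ : M => (1 : ℝ)) j) x (bE l)))
    (hZ2 : ∀ i i', (∀ x, ‖iteratedFDeriv ℝ 2 (𝔄.piece (fun _ : M => (1 : ℝ)) j) x ![bE i, bE i']‖
        ≤ Z2s i i') ∧ HolderWith (Z2h i i') α
          (fun x => iteratedFDeriv ℝ 2 (𝔄.piece (fun _ : M => (1 : ℝ)) j) x ![bE i, bE i']))
    (hZη : ∀ x, ‖𝔄.cutoff j x‖ ≤ Zη)
    (Lop : HolderManifoldFunction 𝔄 ℝ 2 α →L[ℝ] HolderManifoldFunction 𝔄 ℝ 0 α)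
    (hrep : ∀ (u : HolderManifoldFunction 𝔄 ℝ 2 α) (y : E), 𝔄.piece (Lop u) j y =
      𝔄.piece (fun _ : M => (1 : ℝ)) j y *
        ((∑ i, ∑ i', a i i' y * iteratedFDeriv ℝ 2
            (chartRestrictCLM 𝔄 hα1.le j (𝔄.cutoff j) (𝔄.contDiff_cutoff j)
              (𝔄.hasCompactSupport_cutoff j) (𝔄.tsupport_cutoff_subset j) u : E → ℝ) y
            ![bE i, bE i']) +
          (∑ l, b l y * fderiv ℝ (chartRestrictCLM 𝔄 hα1.le j (𝔄.cutoff j) (𝔄.contDiff_cutoff j)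
              (𝔄.hasCompactSupport_cutoff j) (𝔄.tsupport_cutoff_subset j) u : E → ℝ) y (bE l)) +
          c y * (chartRestrictCLM 𝔄 hα1.le j (𝔄.cutoff j) (𝔄.contDiff_cutoff j)
              (𝔄.hasCompactSupport_cutoff j) (𝔄.tsupport_cutoff_subset j) u) y))
    (u : HolderManifoldFunction 𝔄 ℝ 2 α) {A : ℝ} (hA : ∀ x, ‖u x‖ ≤ A) :
    ‖u.toPieces j‖ ≤ C1 * (A + C2 * (2 * ‖Lop u‖ +
      ((∑ i : κ, ∑ i' : κ, (Ka : ℝ) * (2 * Z1s i + Z1h i + 2 * Z1s i' + Z1h i' + 2 * Z2s i i' +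
          Z2h i i')) + (∑ l : κ, (Kb : ℝ) * (Z1h l + 2 * Z1s l)) +
        ((∑ i : κ, ∑ i' : κ, (Ka : ℝ) * (Z1s i + Z1s i' + Z2s i i')) + ∑ l : κ, (Kb : ℝ) * Z1s l)) *
        (5 * (ε * ‖(chartRestrictCLM 𝔄 hα1.le j (𝔄.cutoff j) (𝔄.contDiff_cutoff j)
          (𝔄.hasCompactSupport_cutoff j) (𝔄.tsupport_cutoff_subset j) :
            HolderManifoldFunction 𝔄 ℝ 2 α →L[ℝ] ContDiffHolderFunction E ℝ 2 α)‖ * ‖u‖ +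
          Cε * Zη * A) + 3 * Zη * A) +
      (5 * (ε * ‖u‖ + Cε * A) + 3 * A))) := by
  have hα1' : α ≤ 1 := hα1.le
  -- the objects of the chart
  set K : Set E := 𝔄.chart j '' tsupport (𝔄.ρ j) with hK
  set U : Set E := thickening ρ₁ K with hU
  set R : HolderManifoldFunction 𝔄 ℝ 2 α →L[ℝ] ContDiffHolderFunction E ℝ 2 α :=
    chartRestrictCLM 𝔄 hα1' j (𝔄.cutoff j) (𝔄.contDiff_cutoff j)
      (𝔄.hasCompactSupport_cutoff j) (𝔄.tsupport_cutoff_subset j) with hR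
  set ut : ContDiffHolderFunction E ℝ 2 α := R u with hut
  set v : ContDiffHolderFunction E ℝ 2 α := u.toPieces j with hv
  set ρh : E → ℝ := 𝔄.piece (fun _ : M => (1 : ℝ)) j with hρh
  set f : ContDiffHolderFunction E ℝ 0 α := (Lop u).toPieces j with hf
  have hρhs : ContDiff ℝ ∞ ρh := 𝔄.contDiff_piece contMDiff_const j
  have h2top : ((2 : ℕ) : WithTop ℕ∞) ≤ ((⊤ : ℕ∞) : WithTop ℕ∞) := WithTop.coe_le_coe.mpr le_top
  have hρh2 : ContDiff ℝ 2 ρh := hρhs.of_le (by exact_mod_cast h2top)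
  have hρhd : Differentiable ℝ ρh := hρh2.differentiable (by norm_num)
  have hρht : tsupport ρh ⊆ K := 𝔄.tsupport_piece_subset _ j
  have hKU : K ⊆ U := self_subset_thickening hρ₁ K
  -- coercions and norms
  have hutc : ∀ y, ut y = 𝔄.cutoff j y * u ((𝔄.chart j).symm y) := fun y => by
    rw [hut, hR, chartRestrictCLM_apply, smul_eq_mul]
  have hvcoe : ((v : ContDiffHolderFunction E ℝ 2 α) : E → ℝ) = 𝔄.piece u j := u.coe_toPieces j
  have hfcoe : ((f : ContDiffHolderFunction E ℝ 0 α) : E → ℝ) = 𝔄.piece (Lop u) j :=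
    (Lop u).coe_toPieces j
  have hvρ : ((v : ContDiffHolderFunction E ℝ 2 α) : E → ℝ) = fun y => ρh y * ut y := by
    rw [hvcoe]; funext y; exact 𝔄.piece_eq_piece_one_mul hα1' u j y
  have hvn : ‖v‖ ≤ ‖u‖ := u.norm_toPieces_le j
  have hutn : ‖ut‖ ≤ ‖R‖ * ‖u‖ := R.le_opNorm u
  have hfn : ‖f‖ ≤ ‖Lop u‖ := (Lop u).norm_toPieces_le j
  -- real atoms for the norms (cheap bookkeeping)
  set nR : ℝ := ‖R‖ with hnR
  set nu : ℝ := ‖u‖ with hnu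
  set nL : ℝ := ‖Lop u‖ with hnL
  have hnR0 : 0 ≤ nR := norm_nonneg _
  have hnu0 : 0 ≤ nu := norm_nonneg _
  have hA0 : 0 ≤ A := (norm_nonneg _).trans (hA ((𝔄.chart j).symm 0))
  have hvA : ∀ y, ‖v y‖ ≤ A := fun y => by
    rw [show v y = 𝔄.piece u j y from congrFun hvcoe y]; exact 𝔄.norm_piece_le hA j y
  have hutA : ∀ y, ‖ut y‖ ≤ Zη * A := fun y => by
    rw [hutc, norm_mul]
    exact mul_le_mul (hZη y) (hA _) (norm_nonneg _) (NNReal.coe_nonneg _)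
  have hutc2 : ContDiff ℝ 2 (ut : E → ℝ) := ut.contDiff
  have hutd : Differentiable ℝ (ut : E → ℝ) := hutc2.differentiable (by norm_num)
  -- Step 1: `ε`-interpolation of the lower-order data of `ut` and `v`
  obtain ⟨hD1ut, hD2ut⟩ := hCε ut (Zη * A) hutA
  obtain ⟨hD1v, hD2v⟩ := hCε v A hvA
  set d : ℝ := ε * (nR * nu) + Cε * (Zη * A) with hd
  have hd0 : 0 ≤ d := by positivity
  have hdle : ε * ‖ut‖ + Cε * (Zη * A) ≤ d := by rw [hd]; gcongr
  set dv : ℝ := ε * nu + Cε * A with hdv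
  have hdv0 : 0 ≤ dv := by positivity
  have hdvle : ε * ‖v‖ + Cε * A ≤ dv := by rw [hdv]; gcongr
  set dn : ℝ≥0 := ⟨d, hd0⟩ with hdn
  set dvn : ℝ≥0 := ⟨dv, hdv0⟩ with hdvn
  set An : ℝ≥0 := ⟨A, hA0⟩ with hAn
  have hdn_coe : (dn : ℝ) = d := rfl
  have hdvn_coe : (dvn : ℝ) = dv := rfl
  have hAn_coe : (An : ℝ) = A := rfl
  -- frame data of `ut`
  have hutD1s : ∀ l x, ‖fderiv ℝ (ut : E → ℝ) x (bE l)‖ ≤ (dn : ℝ) := fun l x =>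
    ((fderiv ℝ (ut : E → ℝ) x).le_opNorm (bE l)).trans
      (by rw [bE.norm_eq_one, mul_one]; exact (hD1ut x).trans hdle)
  have hutL : ∀ l x y, dist (fderiv ℝ (ut : E → ℝ) x (bE l)) (fderiv ℝ (ut : E → ℝ) y (bE l)) ≤
      (dn : ℝ) * dist x y := fun l => by
    refine dist_le_mul_of_norm_fderiv_le
      (((hutc2.fderiv_right (m := 1) (by norm_num)).differentiable one_ne_zero).clm_apply
        (differentiable_const _)) fun z => ?_
    refine ContinuousLinearMap.opNorm_le_bound _ hd0 fun w => ?_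
    rw [fderiv_fderiv_apply_eq_iteratedFDeriv_two_real hutc2]
    calc ‖iteratedFDeriv ℝ 2 (ut : E → ℝ) z ![w, bE l]‖
        ≤ ‖iteratedFDeriv ℝ 2 (ut : E → ℝ) z‖ * ∏ i, ‖(![w, bE l] : Fin 2 → E) i‖ :=
          ContinuousMultilinearMap.le_opNorm _ _
      _ ≤ d * ‖w‖ := by
          rw [Fin.prod_univ_two]
          simp only [Matrix.cons_val_zero, Matrix.cons_val_one, bE.norm_eq_one, mul_one]
          exact mul_le_mul_of_nonneg_right ((hD2ut z).trans hdle) (norm_nonneg _)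
  have hutD1h : ∀ l, HolderWith (dn + 2 * dn) α (fun x => fderiv ℝ (ut : E → ℝ) x (bE l)) :=
    fun l => holderWith_of_dist_le_mul_of_norm_le hα1' (hutL l) (hutD1s l)
  have hutUs : ∀ x, ‖(ut : E → ℝ) x‖ ≤ (Zη * An : ℝ≥0) := fun x => by push_cast; exact hutA x
  have hutUh : HolderWith (dn + 2 * (Zη * An)) α (ut : E → ℝ) := by
    refine holderWith_of_dist_le_mul_of_norm_le hα1' (dist_le_mul_of_norm_fderiv_le hutd
      fun z => (hD1ut z).trans hdle) hutUs
  -- frame data of `v`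
  have hvc2 : ContDiff ℝ 2 ((v : ContDiffHolderFunction E ℝ 2 α) : E → ℝ) := v.contDiff
  have hvd : Differentiable ℝ ((v : ContDiffHolderFunction E ℝ 2 α) : E → ℝ) :=
    hvc2.differentiable (by norm_num)
  have hvD1s : ∀ l x, ‖fderiv ℝ ((v : ContDiffHolderFunction E ℝ 2 α) : E → ℝ) x (bE l)‖ ≤
      (dvn : ℝ) := fun l x =>
    ((fderiv ℝ ((v : ContDiffHolderFunction E ℝ 2 α) : E → ℝ) x).le_opNorm (bE l)).trans
      (by rw [bE.norm_eq_one, mul_one]; exact (hD1v x).trans hdvle)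
  have hvL : ∀ l x y, dist (fderiv ℝ ((v : ContDiffHolderFunction E ℝ 2 α) : E → ℝ) x (bE l))
      (fderiv ℝ ((v : ContDiffHolderFunction E ℝ 2 α) : E → ℝ) y (bE l)) ≤ (dvn : ℝ) * dist x y :=
    fun l => by
    refine dist_le_mul_of_norm_fderiv_le
      (((hvc2.fderiv_right (m := 1) (by norm_num)).differentiable one_ne_zero).clm_apply
        (differentiable_const _)) fun z => ?_
    refine ContinuousLinearMap.opNorm_le_bound _ hdv0 fun w => ?_
    rw [fderiv_fderiv_apply_eq_iteratedFDeriv_two_real hvc2]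
    calc ‖iteratedFDeriv ℝ 2 ((v : ContDiffHolderFunction E ℝ 2 α) : E → ℝ) z ![w, bE l]‖
        ≤ ‖iteratedFDeriv ℝ 2 ((v : ContDiffHolderFunction E ℝ 2 α) : E → ℝ) z‖ *
            ∏ i, ‖(![w, bE l] : Fin 2 → E) i‖ := ContinuousMultilinearMap.le_opNorm _ _
      _ ≤ dv * ‖w‖ := by
          rw [Fin.prod_univ_two]
          simp only [Matrix.cons_val_zero, Matrix.cons_val_one, bE.norm_eq_one, mul_one]
          exact mul_le_mul_of_nonneg_right ((hD2v z).trans hdvle) (norm_nonneg _)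
  have hvD1h : ∀ l, HolderWith (dvn + 2 * dvn) α
      (fun x => fderiv ℝ ((v : ContDiffHolderFunction E ℝ 2 α) : E → ℝ) x (bE l)) :=
    fun l => holderWith_of_dist_le_mul_of_norm_le hα1' (hvL l) (hvD1s l)
  have hvUs : ∀ x, ‖((v : ContDiffHolderFunction E ℝ 2 α) : E → ℝ) x‖ ≤ (An : ℝ) := fun x => hvA x
  have hvUh : HolderWith (dvn + 2 * An) α ((v : ContDiffHolderFunction E ℝ 2 α) : E → ℝ) :=
    holderWith_of_dist_le_mul_of_norm_le hα1' (dist_le_mul_of_norm_fderiv_le hvd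
      fun z => (hD1v z).trans hdvle) hvUs
  -- Step 2: `ρ̂` vanishes (with its derivatives) off `K ⊆ U`
  have hzD1ρ : ∀ (l : κ), ∀ x ∉ U, fderiv ℝ ρh x (bE l) = 0 := fun l x hx => by
    rw [fderiv_of_notMem_tsupport ℝ fun h => hx (hKU (hρht h))]; rfl
  have hzD2ρ : ∀ (i i' : κ), ∀ x ∉ U, iteratedFDeriv ℝ 2 ρh x ![bE i, bE i'] = 0 :=
    fun i i' x hx => by
      have : x ∉ tsupport (iteratedFDeriv ℝ 2 ρh) := fun h =>
        hx (hKU (hρht (tsupport_iteratedFDeriv_subset 2 h)))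
      rw [image_eq_zero_of_notMem_tsupport this]; rfl
  -- Step 3: the commutator `[P, ρ̂] ut`
  have hT1 : ∀ i i', HolderWith (Ka * ((Z1s i * (dn + 2 * dn) + Z1h i * dn) +
      (dn * Z1h i' + (dn + 2 * dn) * Z1s i') + ((Zη * An) * Z2h i i' + (dn + 2 * (Zη * An)) * Z2s i i')) +
      Ka * (Z1s i * dn + dn * Z1s i' + (Zη * An) * Z2s i i')) α
      (fun x => a i i' x * (fderiv ℝ ρh x (bE i) * fderiv ℝ (ut : E → ℝ) x (bE i') +
        fderiv ℝ (ut : E → ℝ) x (bE i) * fderiv ℝ ρh x (bE i') +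
        ut x * iteratedFDeriv ℝ 2 ρh x ![bE i, bE i'])) := by
    intro i i'
    have hA' : HolderWith (Z1s i * (dn + 2 * dn) + Z1h i * dn) α
        (fun x => fderiv ℝ ρh x (bE i) * fderiv ℝ (ut : E → ℝ) x (bE i')) :=
      holderWith_mul_of_eq_zero (s := univ) (fun x _ => (hZ1 i).1 x)
        ((hZ1 i).2.holderOnWith univ) (hutD1h i') (hutD1s i') (fun x hx => (hx (mem_univ x)).elim)
    have hB' : HolderWith (dn * Z1h i' + (dn + 2 * dn) * Z1s i') α
        (fun x => fderiv ℝ (ut : E → ℝ) x (bE i) * fderiv ℝ ρh x (bE i')) :=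
      holderWith_mul_of_eq_zero (s := univ) (fun x _ => hutD1s i x)
        ((hutD1h i).holderOnWith univ) (hZ1 i').2 (hZ1 i').1 (fun x hx => (hx (mem_univ x)).elim)
    have hC' : HolderWith ((Zη * An) * Z2h i i' + (dn + 2 * (Zη * An)) * Z2s i i') α
        (fun x => ut x * iteratedFDeriv ℝ 2 ρh x ![bE i, bE i']) :=
      holderWith_mul_of_eq_zero (s := univ) (fun x _ => hutUs x)
        (hutUh.holderOnWith univ) (hZ2 i i').2 (hZ2 i i').1 (fun x hx => (hx (mem_univ x)).elim)
    have hh : HolderWith ((Z1s i * (dn + 2 * dn) + Z1h i * dn) +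
        (dn * Z1h i' + (dn + 2 * dn) * Z1s i') + ((Zη * An) * Z2h i i' + (dn + 2 * (Zη * An)) * Z2s i i')) α
        (fun x => fderiv ℝ ρh x (bE i) * fderiv ℝ (ut : E → ℝ) x (bE i') +
          fderiv ℝ (ut : E → ℝ) x (bE i) * fderiv ℝ ρh x (bE i') +
          ut x * iteratedFDeriv ℝ 2 ρh x ![bE i, bE i']) := (hA'.add hB').add hC'
    have hhs : ∀ x, ‖fderiv ℝ ρh x (bE i) * fderiv ℝ (ut : E → ℝ) x (bE i') +
        fderiv ℝ (ut : E → ℝ) x (bE i) * fderiv ℝ ρh x (bE i') +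
        ut x * iteratedFDeriv ℝ 2 ρh x ![bE i, bE i']‖ ≤
        (Z1s i * dn + dn * Z1s i' + (Zη * An) * Z2s i i' : ℝ≥0) := by
      intro x
      push_cast
      refine (norm_add_le _ _).trans (add_le_add ((norm_add_le _ _).trans (add_le_add ?_ ?_)) ?_)
      · rw [norm_mul]
        exact mul_le_mul ((hZ1 i).1 x) (hutD1s i' x) (norm_nonneg _) (NNReal.coe_nonneg _)
      · rw [norm_mul]
        exact mul_le_mul (hutD1s i x) ((hZ1 i').1 x) (norm_nonneg _) hd0
      · rw [norm_mul]
        exact mul_le_mul (hutA x) ((hZ2 i i').1 x) (norm_nonneg _) (by positivity)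
    have hhz : ∀ x ∉ U, fderiv ℝ ρh x (bE i) * fderiv ℝ (ut : E → ℝ) x (bE i') +
        fderiv ℝ (ut : E → ℝ) x (bE i) * fderiv ℝ ρh x (bE i') +
        ut x * iteratedFDeriv ℝ 2 ρh x ![bE i, bE i'] = 0 := fun x hx => by
      rw [hzD1ρ i x hx, hzD1ρ i' x hx, hzD2ρ i i' x hx]; ring
    exact holderWith_mul_of_eq_zero (s := U) (ha0 i i') (haH i i') hh hhs hhz
  have hT2 : ∀ l, HolderWith (Kb * ((Zη * An) * Z1h l + (dn + 2 * (Zη * An)) * Z1s l) +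
      Kb * ((Zη * An) * Z1s l)) α (fun x => b l x * (ut x * fderiv ℝ ρh x (bE l))) := by
    intro l
    have hh : HolderWith ((Zη * An) * Z1h l + (dn + 2 * (Zη * An)) * Z1s l) α
        (fun x => ut x * fderiv ℝ ρh x (bE l)) :=
      holderWith_mul_of_eq_zero (s := univ) (fun x _ => hutUs x) (hutUh.holderOnWith univ)
        (hZ1 l).2 (hZ1 l).1 (fun x hx => (hx (mem_univ x)).elim)
    have hhs : ∀ x, ‖ut x * fderiv ℝ ρh x (bE l)‖ ≤ ((Zη * An) * Z1s l : ℝ≥0) := fun x => by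
      push_cast; rw [norm_mul]
      exact mul_le_mul (hutA x) ((hZ1 l).1 x) (norm_nonneg _) (by positivity)
    have hhz : ∀ x ∉ U, ut x * fderiv ℝ ρh x (bE l) = 0 := fun x hx => by
      rw [hzD1ρ l x hx, mul_zero]
    exact holderWith_mul_of_eq_zero (s := U) (hb0 l) (hbH l) hh hhs hhz
  set CPc : ℝ≥0 := (∑ i, ∑ i', (Ka * ((Z1s i * (dn + 2 * dn) + Z1h i * dn) +
      (dn * Z1h i' + (dn + 2 * dn) * Z1s i') + ((Zη * An) * Z2h i i' + (dn + 2 * (Zη * An)) * Z2s i i')) +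
      Ka * (Z1s i * dn + dn * Z1s i' + (Zη * An) * Z2s i i'))) +
    ∑ l, (Kb * ((Zη * An) * Z1h l + (dn + 2 * (Zη * An)) * Z1s l) + Kb * ((Zη * An) * Z1s l))
    with hCPc
  have hcomm : HolderWith CPc α (fun x =>
      (∑ i, ∑ i', a i i' x * (fderiv ℝ ρh x (bE i) * fderiv ℝ (ut : E → ℝ) x (bE i') +
        fderiv ℝ (ut : E → ℝ) x (bE i) * fderiv ℝ ρh x (bE i') +
        ut x * iteratedFDeriv ℝ 2 ρh x ![bE i, bE i'])) +
      ∑ l, b l x * (ut x * fderiv ℝ ρh x (bE l))) := by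
    have h1 := holderWith_finset_sum (f := fun i x => ∑ i', a i i' x *
        (fderiv ℝ ρh x (bE i) * fderiv ℝ (ut : E → ℝ) x (bE i') +
          fderiv ℝ (ut : E → ℝ) x (bE i) * fderiv ℝ ρh x (bE i') +
          ut x * iteratedFDeriv ℝ 2 ρh x ![bE i, bE i'])) Finset.univ fun i _ =>
      holderWith_finset_sum (f := fun i' x => a i i' x *
        (fderiv ℝ ρh x (bE i) * fderiv ℝ (ut : E → ℝ) x (bE i') +
          fderiv ℝ (ut : E → ℝ) x (bE i) * fderiv ℝ ρh x (bE i') +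
          ut x * iteratedFDeriv ℝ 2 ρh x ![bE i, bE i'])) Finset.univ fun i' _ => hT1 i i'
    have h2 := holderWith_finset_sum (f := fun l x => b l x * (ut x * fderiv ℝ ρh x (bE l)))
      Finset.univ fun l _ => hT2 l
    exact h1.add h2
  set Psc : ℝ≥0 := (∑ i, ∑ i', Ka * (Z1s i * dn + dn * Z1s i' + (Zη * An) * Z2s i i')) +
    ∑ l, Kb * ((Zη * An) * Z1s l) with hPsc
  have hcomms : ∀ x, ‖(∑ i, ∑ i', a i i' x * (fderiv ℝ ρh x (bE i) * fderiv ℝ (ut : E → ℝ) x (bE i') +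
        fderiv ℝ (ut : E → ℝ) x (bE i) * fderiv ℝ ρh x (bE i') +
        ut x * iteratedFDeriv ℝ 2 ρh x ![bE i, bE i'])) +
      ∑ l, b l x * (ut x * fderiv ℝ ρh x (bE l))‖ ≤ (Psc : ℝ) := by
    intro x
    rw [hPsc]
    push_cast
    refine (norm_add_le _ _).trans (add_le_add ?_ ?_)
    · refine (norm_sum_le _ _).trans (Finset.sum_le_sum fun i _ => (norm_sum_le _ _).trans
        (Finset.sum_le_sum fun i' _ => ?_))
      by_cases hx : x ∈ U
      · rw [norm_mul]
        refine mul_le_mul (ha0 i i' x hx) ?_ (norm_nonneg _) (NNReal.coe_nonneg _)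
        refine (norm_add_le _ _).trans (add_le_add ((norm_add_le _ _).trans (add_le_add ?_ ?_)) ?_)
        · rw [norm_mul]
          exact mul_le_mul ((hZ1 i).1 x) (hutD1s i' x) (norm_nonneg _) (NNReal.coe_nonneg _)
        · rw [norm_mul]
          exact mul_le_mul (hutD1s i x) ((hZ1 i').1 x) (norm_nonneg _) hd0
        · rw [norm_mul]
          exact mul_le_mul (hutA x) ((hZ2 i i').1 x) (norm_nonneg _) (by positivity)
      · rw [hzD1ρ i x hx, hzD1ρ i' x hx, hzD2ρ i i' x hx]
        simp only [zero_mul, mul_zero, add_zero, norm_zero]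
        positivity
    · refine (norm_sum_le _ _).trans (Finset.sum_le_sum fun l _ => ?_)
      by_cases hx : x ∈ U
      · rw [norm_mul, norm_mul]
        refine mul_le_mul (hb0 l x hx) (mul_le_mul (hutA x) ((hZ1 l).1 x) (norm_nonneg _)
          (by positivity)) (by positivity) (NNReal.coe_nonneg _)
      · rw [hzD1ρ l x hx]
        simp only [mul_zero, norm_zero]
        positivity
  -- Step 4: `P v = f + [P, ρ̂] ut`
  have hPv : (fun x => (∑ i, ∑ i', a i i' x *
        iteratedFDeriv ℝ 2 ((v : ContDiffHolderFunction E ℝ 2 α) : E → ℝ) x ![bE i, bE i']) +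
      (∑ l, b l x * fderiv ℝ ((v : ContDiffHolderFunction E ℝ 2 α) : E → ℝ) x (bE l)) +
      c x * ((v : ContDiffHolderFunction E ℝ 2 α) : E → ℝ) x) =
      fun x => f x + ((∑ i, ∑ i', a i i' x *
        (fderiv ℝ ρh x (bE i) * fderiv ℝ (ut : E → ℝ) x (bE i') +
          fderiv ℝ (ut : E → ℝ) x (bE i) * fderiv ℝ ρh x (bE i') +
          ut x * iteratedFDeriv ℝ 2 ρh x ![bE i, bE i'])) +
        ∑ l, b l x * (ut x * fderiv ℝ ρh x (bE l))) := by
    funext x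
    have hfx : f x = ρh x * ((∑ i, ∑ i', a i i' x * iteratedFDeriv ℝ 2 (ut : E → ℝ) x ![bE i, bE i']) +
        (∑ l, b l x * fderiv ℝ (ut : E → ℝ) x (bE l)) + c x * ut x) := by
      rw [show f x = 𝔄.piece (Lop u) j x from congrFun hfcoe x, hrep u x]
    rw [hfx, hvρ]
    simp only [iteratedFDeriv_two_mul_apply_eq hρh2 hutc2, fderiv_mul_apply_eq hρhd hutd,
      mul_add, Finset.sum_add_distrib, Finset.mul_sum]
    simp only [mul_comm, mul_left_comm]
    abel
  have hfH : HolderWith ‖f‖₊ α (f : E → ℝ) := f.holderWith_of_zero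
  have hPvH : HolderWith (‖f‖₊ + CPc) α (fun x => (∑ i, ∑ i', a i i' x *
        iteratedFDeriv ℝ 2 ((v : ContDiffHolderFunction E ℝ 2 α) : E → ℝ) x ![bE i, bE i']) +
      (∑ l, b l x * fderiv ℝ ((v : ContDiffHolderFunction E ℝ 2 α) : E → ℝ) x (bE l)) +
      c x * ((v : ContDiffHolderFunction E ℝ 2 α) : E → ℝ) x) := by
    rw [hPv]; exact hfH.add hcomm
  have hPvs : ∀ x, ‖(∑ i, ∑ i', a i i' x *
        iteratedFDeriv ℝ 2 ((v : ContDiffHolderFunction E ℝ 2 α) : E → ℝ) x ![bE i, bE i']) +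
      (∑ l, b l x * fderiv ℝ ((v : ContDiffHolderFunction E ℝ 2 α) : E → ℝ) x (bE l)) +
      c x * ((v : ContDiffHolderFunction E ℝ 2 α) : E → ℝ) x‖ ≤ (‖f‖₊ + Psc : ℝ≥0) := by
    intro x
    have hx := congrFun hPv x
    rw [hx]
    push_cast
    exact (norm_add_le _ _).trans (add_le_add (f.norm_apply_le_norm x) (hcomms x))
  -- Step 5: the compact-support estimate for `v` and the norm from entries
  have hvt : tsupport ((v : ContDiffHolderFunction E ℝ 2 α) : E → ℝ) ⊆ K := by
    rw [hvcoe]; exact 𝔄.tsupport_piece_subset _ j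
  have hH := hC2 _ v.memContDiffHolder hvt (‖f‖₊ + CPc) (‖f‖₊ + Psc) dvn (dvn + 2 * dvn) An
    (dvn + 2 * An) hPvH hPvs hvD1s hvD1h hvUs hvUh
  have hvnorm := hC1 v _ A hH hvA
  refine hvnorm.trans (mul_le_mul_of_nonneg_left (add_le_add le_rfl ?_) hC10)
  push_cast
  refine mul_le_mul_of_nonneg_left ?_ (NNReal.coe_nonneg _)
  -- Step 6: bookkeeping, in `ℝ≥0` (drop the analysis from the context first)
  clear hH hvnorm hPvs hPvH hfH hPv hcomms hcomm hT2 hT1 hzD2ρ hzD1ρ hvUh hvUs hvD1h hvL hvD1s hvd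
    hvc2 hutUh hutUs hutD1h hutL hutD1s hD2v hD1v hD2ut hD1ut hutd hutc2 hutA hvA hvρ hfcoe hvcoe
    hutc hKU hρht hρhd hρh2 hρhs hC2 hrep hC1 hCε hZ1 hZ2 haH hbH ha0 hb0 hvt hdle hdvle hutn hvn
  set nf : ℝ := ‖f‖ with hnf
  clear_value nf nR nu nL
  have hX0 : 0 ≤ 5 * (ε * nR * nu + Cε * Zη * A) + 3 * Zη * A := by positivity
  set Xn : ℝ≥0 := ⟨5 * (ε * nR * nu + Cε * Zη * A) + 3 * Zη * A, hX0⟩ with hXn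
  have hXn_coe : (Xn : ℝ) = 5 * (ε * nR * nu + Cε * Zη * A) + 3 * Zη * A := rfl
  have hZA0 : 0 ≤ (Zη : ℝ) * A := mul_nonneg (NNReal.coe_nonneg _) hA0
  have ht1 : 0 ≤ ε * (nR * nu) := by positivity
  have ht2 : 0 ≤ Cε * (Zη * A) := by positivity
  have hdX : dn ≤ Xn := by
    rw [← NNReal.coe_le_coe, hdn_coe, hXn_coe, hd]; linarith
  have h3dX : dn + 2 * dn ≤ Xn := by
    rw [← NNReal.coe_le_coe]; push_cast; rw [hdn_coe, hXn_coe, hd]; linarith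
  have hUsX : Zη * An ≤ Xn := by
    rw [← NNReal.coe_le_coe]; push_cast; rw [hAn_coe, hXn_coe]; linarith
  have hUhX : dn + 2 * (Zη * An) ≤ Xn := by
    rw [← NNReal.coe_le_coe]; push_cast; rw [hdn_coe, hAn_coe, hXn_coe, hd]; linarith
  have hCPcX : CPc ≤ ((∑ i, ∑ i', Ka * (2 * Z1s i + Z1h i + 2 * Z1s i' + Z1h i' + 2 * Z2s i i' +
      Z2h i i')) + ∑ l, Kb * (Z1h l + 2 * Z1s l)) * Xn := by
    calc CPc ≤ (∑ i, ∑ i', (Ka * ((Z1s i * Xn + Z1h i * Xn) + (Xn * Z1h i' + Xn * Z1s i') +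
          (Xn * Z2h i i' + Xn * Z2s i i')) + Ka * (Z1s i * Xn + Xn * Z1s i' + Xn * Z2s i i'))) +
        ∑ l, (Kb * (Xn * Z1h l + Xn * Z1s l) + Kb * (Xn * Z1s l)) := by
          rw [hCPc]
          gcongr
      _ = _ := by
          have e2 : (∑ i, ∑ i', (Ka * ((Z1s i * Xn + Z1h i * Xn) + (Xn * Z1h i' + Xn * Z1s i') +
              (Xn * Z2h i i' + Xn * Z2s i i')) + Ka * (Z1s i * Xn + Xn * Z1s i' + Xn * Z2s i i'))) =
              ∑ i, ∑ i', Ka * (2 * Z1s i + Z1h i + 2 * Z1s i' + Z1h i' + 2 * Z2s i i' +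
                Z2h i i') * Xn :=
            Finset.sum_congr rfl fun i _ => Finset.sum_congr rfl fun i' _ => by ring
          have e3 : (∑ l, (Kb * (Xn * Z1h l + Xn * Z1s l) + Kb * (Xn * Z1s l))) =
              ∑ l, Kb * (Z1h l + 2 * Z1s l) * Xn := Finset.sum_congr rfl fun l _ => by ring
          rw [e2, e3]
          simp only [Finset.sum_mul, add_mul]
  have hPscX : Psc ≤ ((∑ i, ∑ i', Ka * (Z1s i + Z1s i' + Z2s i i')) + ∑ l, Kb * Z1s l) * Xn := by
    calc Psc ≤ (∑ i, ∑ i', Ka * (Z1s i * Xn + Xn * Z1s i' + Xn * Z2s i i')) +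
        ∑ l, Kb * (Xn * Z1s l) := by
          rw [hPsc]
          gcongr
      _ = _ := by
          have e2 : (∑ i, ∑ i', Ka * (Z1s i * Xn + Xn * Z1s i' + Xn * Z2s i i')) =
              ∑ i, ∑ i', Ka * (Z1s i + Z1s i' + Z2s i i') * Xn :=
            Finset.sum_congr rfl fun i _ => Finset.sum_congr rfl fun i' _ => by ring
          have e3 : (∑ l, Kb * (Xn * Z1s l)) = ∑ l, Kb * Z1s l * Xn :=
            Finset.sum_congr rfl fun l _ => by ring
          rw [e2, e3]
          simp only [Finset.sum_mul, add_mul]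
  have hCPcX' := NNReal.coe_le_coe.2 hCPcX
  have hPscX' := NNReal.coe_le_coe.2 hPscX
  push_cast at hCPcX' hPscX' ⊢
  rw [hXn_coe] at hCPcX' hPscX'
  rw [hdvn_coe, hAn_coe, hdv]
  linarith [hfn, hCPcX', hPscX']

set_option maxHeartbeats 800000 in
-- a long proof with many opaque constants
/-- **Global Schauder estimate on a closed manifold** (Gilbarg–Trudinger 2001, Thm. 6.2, patched
over the chart data `𝔄`; no boundary). For fixed ellipticity and Hölder bounds of the chart
coefficients on the `ρ₁`-thickenings of `K_j = chart_j(tsupport ρ_j)` there is `C` with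
`‖u‖_{C^{2,α}_𝔄} ≤ C (‖L u‖_{C^{0,α}_𝔄} + sup |u|)` for every bounded operator `L` whose chart
pieces are `ρ̂_j P_j(ũ_j)`. [cite: GilbargTrudinger2001, Thm. 6.2, §6.1] -/
theorem exists_schauder_global (𝔄 : HolderChartData ι E M) (bE : OrthonormalBasis κ ℝ E)
    {α : ℝ≥0} (hα0 : 0 < α) (hα1 : α < 1) {l : ℝ} (hl : 0 < l) (L : ℝ) (Ka Kb Kc : ℝ≥0) {ρ₁ : ℝ}
    (hρ₁ : 0 < ρ₁) :
    ∃ C : ℝ, 0 ≤ C ∧ ∀ (a : ι → κ → κ → E → ℝ) (b : ι → κ → E → ℝ) (c : ι → E → ℝ),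
      (∀ j i i' x, a j i i' x = a j i' i x) →
      (∀ j, ∀ x ∈ thickening ρ₁ (𝔄.chart j '' tsupport (𝔄.ρ j)), ∀ ξ : κ → ℝ,
        l * ∑ i, ξ i ^ 2 ≤ ∑ i, ∑ i', a j i i' x * ξ i * ξ i') →
      (∀ j, ∀ x ∈ thickening ρ₁ (𝔄.chart j '' tsupport (𝔄.ρ j)), ∀ ξ : κ → ℝ,
        ∑ i, ∑ i', a j i i' x * ξ i * ξ i' ≤ L * ∑ i, ξ i ^ 2) →
      (∀ j i i', ∀ x ∈ thickening ρ₁ (𝔄.chart j '' tsupport (𝔄.ρ j)), ‖a j i i' x‖ ≤ Ka) →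
      (∀ j i i', HolderOnWith Ka α (a j i i') (thickening ρ₁ (𝔄.chart j '' tsupport (𝔄.ρ j)))) →
      (∀ j l' x, x ∈ thickening ρ₁ (𝔄.chart j '' tsupport (𝔄.ρ j)) → ‖b j l' x‖ ≤ Kb) →
      (∀ j l', HolderOnWith Kb α (b j l') (thickening ρ₁ (𝔄.chart j '' tsupport (𝔄.ρ j)))) →
      (∀ j, ∀ x ∈ thickening ρ₁ (𝔄.chart j '' tsupport (𝔄.ρ j)), ‖c j x‖ ≤ Kc) →
      (∀ j, HolderOnWith Kc α (c j) (thickening ρ₁ (𝔄.chart j '' tsupport (𝔄.ρ j)))) →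
      ∀ (Lop : HolderManifoldFunction 𝔄 ℝ 2 α →L[ℝ] HolderManifoldFunction 𝔄 ℝ 0 α),
        (∀ (u : HolderManifoldFunction 𝔄 ℝ 2 α) (j : ι) (y : E), 𝔄.piece (Lop u) j y =
          𝔄.piece (fun _ : M => (1 : ℝ)) j y *
            ((∑ i, ∑ i', a j i i' y * iteratedFDeriv ℝ 2
                (chartRestrictCLM 𝔄 hα1.le j (𝔄.cutoff j) (𝔄.contDiff_cutoff j)
                  (𝔄.hasCompactSupport_cutoff j) (𝔄.tsupport_cutoff_subset j) u : E → ℝ) y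
                ![bE i, bE i']) +
              (∑ l', b j l' y * fderiv ℝ (chartRestrictCLM 𝔄 hα1.le j (𝔄.cutoff j)
                  (𝔄.contDiff_cutoff j) (𝔄.hasCompactSupport_cutoff j)
                  (𝔄.tsupport_cutoff_subset j) u : E → ℝ) y (bE l')) +
              c j y * (chartRestrictCLM 𝔄 hα1.le j (𝔄.cutoff j) (𝔄.contDiff_cutoff j)
                  (𝔄.hasCompactSupport_cutoff j) (𝔄.tsupport_cutoff_subset j) u) y)) →
        ∀ (u : HolderManifoldFunction 𝔄 ℝ 2 α) (A : ℝ), (∀ x, ‖u x‖ ≤ A) →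
          ‖u‖ ≤ C * (‖Lop u‖ + A) := by
  have hα1' : α ≤ 1 := hα1.le
  -- the constants of parts C1, C2
  obtain ⟨C1, hC10, hC1⟩ := exists_norm_le_of_entries (F := ℝ) bE hα0
  choose C2 hC2 using fun j : ι => exists_schauder_compact_support bE hα0 hα1 hl L Ka Kb Kc
    (𝔄.isCompact_image_tsupport j).1 hρ₁
  -- bounds of the pulled-back partition functions and of the cutoffs
  set ρh : ι → E → ℝ := fun j => 𝔄.piece (fun _ : M => (1 : ℝ)) j with hρh
  have hρhs : ∀ j, ContDiff ℝ ∞ (ρh j) := fun j => 𝔄.contDiff_piece contMDiff_const j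
  have h3top : ((3 : ℕ) : WithTop ℕ∞) ≤ ((⊤ : ℕ∞) : WithTop ℕ∞) := WithTop.coe_le_coe.mpr le_top
  have hρh3 : ∀ j, ContDiff ℝ 3 (ρh j) := fun j => (hρhs j).of_le (by exact_mod_cast h3top)
  have hρh2 : ∀ j, ContDiff ℝ 2 (ρh j) := fun j => (hρh3 j).of_le (by norm_num)
  have hρhc : ∀ j, HasCompactSupport (ρh j) := fun j => 𝔄.hasCompactSupport_piece _ j
  have hD1 : ∀ j (l' : κ), ContDiff ℝ 1 (fun x => fderiv ℝ (ρh j) x (bE l')) ∧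
      HasCompactSupport (fun x => fderiv ℝ (ρh j) x (bE l')) := fun j l' =>
    ⟨((hρh2 j).fderiv_right (m := 1) (by norm_num)).clm_apply contDiff_const,
      (hρhc j).fderiv_apply (𝕜 := ℝ) (bE l')⟩
  have hD2 : ∀ j (i i' : κ), ContDiff ℝ 1 (fun x => iteratedFDeriv ℝ 2 (ρh j) x ![bE i, bE i']) ∧
      HasCompactSupport (fun x => iteratedFDeriv ℝ 2 (ρh j) x ![bE i, bE i']) := fun j i i' => by
    have heq : (fun x => iteratedFDeriv ℝ 2 (ρh j) x ![bE i, bE i']) =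
        fun x => fderiv ℝ (fun y => fderiv ℝ (ρh j) y (bE i')) x (bE i) :=
      funext fun x => (fderiv_fderiv_apply_eq_iteratedFDeriv_two_real (hρh2 j) (bE i) (bE i') x).symm
    rw [heq]
    exact ⟨((((hρh3 j).fderiv_right (m := 2) (by norm_num)).clm_apply
      contDiff_const).fderiv_right (m := 1) (by norm_num)).clm_apply contDiff_const,
      ((hρhc j).fderiv_apply (𝕜 := ℝ) (bE i')).fderiv_apply (𝕜 := ℝ) (bE i)⟩
  choose Z1s Z1h hZ1 using fun j l' =>
    exists_bound_holderWith_of_hasCompactSupport (hD1 j l').1 (hD1 j l').2 hα1'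
  choose Z2s Z2h hZ2 using fun j i i' =>
    exists_bound_holderWith_of_hasCompactSupport (hD2 j i i').1 (hD2 j i i').2 hα1'
  have hZη' : ∀ j, ∃ Zη : ℝ≥0, ∀ x, ‖𝔄.cutoff j x‖ ≤ Zη := fun j => by
    obtain ⟨C, hC⟩ := (𝔄.contDiff_cutoff j).continuous.bounded_above_of_compact_support
      (𝔄.hasCompactSupport_cutoff j)
    exact ⟨⟨max C 0, le_max_right _ _⟩, fun x => (hC x).trans (le_max_left _ _)⟩
  choose Zη hZη using hZη'
  -- the chart restrictions and their norms
  set nR : ι → ℝ := fun j => ‖(chartRestrictCLM 𝔄 hα1' j (𝔄.cutoff j) (𝔄.contDiff_cutoff j)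
    (𝔄.hasCompactSupport_cutoff j) (𝔄.tsupport_cutoff_subset j) :
      HolderManifoldFunction 𝔄 ℝ 2 α →L[ℝ] ContDiffHolderFunction E ℝ 2 α)‖ with hnR
  have hnR0 : ∀ j, 0 ≤ nR j := fun j => norm_nonneg _
  -- the combinatorial constants
  set Kz : ι → ℝ := fun j => (∑ i : κ, ∑ i' : κ, (Ka : ℝ) * (2 * Z1s j i + Z1h j i + 2 * Z1s j i' +
      Z1h j i' + 2 * Z2s j i i' + Z2h j i i')) + (∑ l' : κ, (Kb : ℝ) * (Z1h j l' + 2 * Z1s j l')) +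
    ((∑ i : κ, ∑ i' : κ, (Ka : ℝ) * (Z1s j i + Z1s j i' + Z2s j i i')) +
      ∑ l' : κ, (Kb : ℝ) * Z1s j l') with hKz
  have hKz0 : ∀ j, 0 ≤ Kz j := fun j => by rw [hKz]; positivity
  -- choice of `ε`
  set T : ℝ := ∑ j, C1 * C2 j * 5 * (Kz j * nR j + 1) with hT
  have hT0 : 0 ≤ T := by rw [hT]; positivity
  have hTj : ∀ j, C1 * C2 j * 5 * (Kz j * nR j + 1) ≤ T := fun j => by
    rw [hT]
    exact Finset.single_le_sum (f := fun j => C1 * C2 j * 5 * (Kz j * nR j + 1))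
      (fun j _ => by positivity) (Finset.mem_univ j)
  set ε : ℝ := 1 / (2 * T + 1) with hε
  have hε0 : 0 < ε := by rw [hε]; positivity
  have hεT : ε * T ≤ 1 / 2 := by
    rw [hε, div_mul_eq_mul_div, one_mul, div_le_iff₀ (by positivity)]; linarith
  obtain ⟨Cε, hCε0, hCε⟩ := exists_lowerOrder_le (E := E) (F := ℝ) hα0 hα1' hε0
  -- the constant
  set Acoef : ι → ℝ := fun j => C1 + C1 * C2 j * (Kz j * (5 * Cε * Zη j + 3 * Zη j) + 5 * Cε + 3)
    with hAcoef
  set C : ℝ := 2 * ∑ j, (Acoef j + 2 * C1 * C2 j) with hC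
  have hAcoef0 : ∀ j, 0 ≤ Acoef j := fun j => by rw [hAcoef]; positivity
  have hC0 : 0 ≤ C := by rw [hC]; positivity
  refine ⟨C, hC0, ?_⟩
  intro a b c hsymm hlow hup ha0 haH hb0 hbH hc0 hcH Lop hrep u A hA
  rcases isEmpty_or_nonempty ι with hι | hι
  · have h0 : ‖u‖ = 0 := by
      rw [HolderManifoldFunction.norm_def, Subsingleton.elim u.toPieces 0, norm_zero]
    have hC' : C = 0 := by rw [hC, Finset.univ_eq_empty, Finset.sum_empty, mul_zero]
    rw [h0, hC', zero_mul]
  obtain ⟨j₀⟩ := hι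
  have hA0 : 0 ≤ A := (norm_nonneg _).trans (hA ((𝔄.chart j₀).symm 0))
  set nu : ℝ := ‖u‖ with hnu
  set nL : ℝ := ‖Lop u‖ with hnL
  have hnu0 : 0 ≤ nu := norm_nonneg _
  have hnL0 : 0 ≤ nL := norm_nonneg _
  -- Step 1: the estimate of each chart piece
  have key : ∀ j, ‖u.toPieces j‖ ≤ C1 * (A + C2 j * (2 * nL +
      Kz j * (5 * (ε * nR j * nu + Cε * Zη j * A) + 3 * Zη j * A) +
        (5 * (ε * nu + Cε * A) + 3 * A))) := fun j =>
    schauder_global_piece 𝔄 bE hα1 j (a j) (b j) (c j) hρ₁ (ha0 j) (haH j) (hb0 j) (hbH j)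
      (hC2 j (a j) (b j) (c j) (hsymm j)
        (fun y hy x hx ξ => hlow j x (ball_subset_thickening hy ρ₁ hx) ξ)
        (fun y hy x hx ξ => hup j x (ball_subset_thickening hy ρ₁ hx) ξ)
        (fun y hy i i' x hx => ha0 j i i' x (ball_subset_thickening hy ρ₁ hx))
        (fun y hy i i' => (haH j i i').mono (ball_subset_thickening hy ρ₁))
        (fun y hy l' x hx => hb0 j l' x (ball_subset_thickening hy ρ₁ hx))
        (fun y hy l' => (hbH j l').mono (ball_subset_thickening hy ρ₁))
        (fun y hy x hx => hc0 j x (ball_subset_thickening hy ρ₁ hx))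
        (fun y hy => (hcH j).mono (ball_subset_thickening hy ρ₁)))
      hC10 hC1 hε0 hCε0 (fun v A' h => ⟨(hCε v A' h).1, (hCε v A' h).2.1⟩) (hZ1 j) (hZ2 j)
      (hZη j) Lop (fun u' y => hrep u' j y) u hA
  -- Step 2: absorb the `ε`-terms (arithmetic only: make the atoms opaque first)
  clear hrep hC2 hC1 hCε hZ1 hZ2 hZη hD1 hD2 hρhc hρh2 hρh3 hρhs
  clear_value nu nL nR Kz T ε Acoef C ρh
  have key' : ∀ j, ‖u.toPieces j‖ ≤ 1 / 2 * nu + Acoef j * A + 2 * C1 * C2 j * nL := by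
    intro j
    have hnRj := hnR0 j
    have hKzj := hKz0 j
    have hexp : C1 * (A + C2 j * (2 * nL +
        Kz j * (5 * (ε * nR j * nu + Cε * Zη j * A) + 3 * Zη j * A) +
          (5 * (ε * nu + Cε * A) + 3 * A))) =
        C1 * C2 j * 5 * (Kz j * nR j + 1) * (ε * nu) + Acoef j * A + 2 * C1 * C2 j * nL := by
      simp only [hAcoef]; ring
    have h1 : C1 * C2 j * 5 * (Kz j * nR j + 1) * (ε * nu) ≤ 1 / 2 * nu :=
      calc C1 * C2 j * 5 * (Kz j * nR j + 1) * (ε * nu) ≤ T * (ε * nu) :=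
            mul_le_mul_of_nonneg_right (hTj j) (by positivity)
        _ = ε * T * nu := by ring
        _ ≤ 1 / 2 * nu := mul_le_mul_of_nonneg_right hεT hnu0
    linarith [key j, hexp, h1]
  -- Step 3: take the maximum over the charts
  have hSA : ∀ j, Acoef j ≤ ∑ j', Acoef j' := fun j =>
    Finset.single_le_sum (f := Acoef) (fun j _ => hAcoef0 j) (Finset.mem_univ j)
  have hSL : ∀ j, 2 * C1 * C2 j ≤ ∑ j', 2 * C1 * C2 j' := fun j =>
    Finset.single_le_sum (f := fun j' => 2 * C1 * C2 j') (fun j _ => by positivity)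
      (Finset.mem_univ j)
  have hSA0 : 0 ≤ ∑ j', Acoef j' := Finset.sum_nonneg fun j _ => hAcoef0 j
  have hSL0 : 0 ≤ ∑ j', 2 * C1 * (C2 j' : ℝ) := Finset.sum_nonneg fun j _ => by positivity
  have hB0 : 0 ≤ 1 / 2 * nu + (∑ j', Acoef j') * A + (∑ j', 2 * C1 * C2 j') * nL :=
    add_nonneg (add_nonneg (by positivity) (mul_nonneg hSA0 hA0)) (mul_nonneg hSL0 hnL0)
  have hB : nu ≤ 1 / 2 * nu + (∑ j', Acoef j') * A + (∑ j', 2 * C1 * C2 j') * nL := by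
    have h : ‖u.toPieces‖ ≤ _ := (pi_norm_le_iff_of_nonneg hB0).2 fun j =>
      (key' j).trans (by nlinarith [hSA j, hSL j, hA0, hnL0])
    rwa [← HolderManifoldFunction.norm_def, ← hnu] at h
  have hCeq : C = 2 * ∑ j', Acoef j' + 2 * ∑ j', 2 * C1 * C2 j' := by
    rw [hC, Finset.sum_add_distrib, mul_add]
  rw [hCeq]
  nlinarith [hB, mul_nonneg hSA0 hnL0, mul_nonneg hSL0 hA0]

end Global

end Literature.Analysis.FunctionSpaces

end
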